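/-
Copyright (c) 2026 the pub-hodgecm-mathlib formalisation cell (harness21).  Prover seat hodgecm-mathlib-B-p04 (g61), req618 STAGE 1a «FOUR-FRAME» squad, Track A TIER 2
for the tier-1 socket `U1_Frames` (this seat's unit as assembler, cand v2 e7b07868a0ec7c84): the payment of `stub_U1_frameClasses_distinct` — the four frame literals
`t_b` (one-place matrix `z·Γ_b`) are PAIRWISE NON-CONJUGATE in `U(Φ₃)(L⁺_v)`.  2026-09-03.
-/
import Literature.NumberTheory.Rogawski1990.LocalTransferIdentityCoreDyadicDescent                -- (organ vocabulary, as the socket) `cmDatum`, …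
import Literature.NumberTheory.Rogawski1990.ShalikaGermExpansionUnitaryThreeNonsplitCM             -- (organ vocabulary, as the socket)
import Literature.NumberTheory.Rogawski1990.LocalTransferAtOneOfShalikaRankUnramifiedAll           -- (organ vocabulary, as the socket) ★ `localNonsplitEquiv`; brings ★ `placeForm_antidiagOne`
import Literature.NumberTheory.Automorphic.LocalUnitaryGroupCongr                                  -- (organ vocabulary, as the socket) ★ `galAdicCompletionMap`, `placeForm`
import Literature.NumberTheory.Automorphic.UnitaryThreeFourFrameEigenframe                         -- ★ p854605 (B-p04): `frameElt_mulVec_frame`, `frameElt_mul_frameMatrix`, `frameMatrix_mulVec(_injective)`, `isUnit_det_frameMatrix`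
import Summits.HodgeConjecture.HodgeConjecture.Theorems.F0P3cDyRamFrameApartmentVertex             -- ★ p854632 (B-p04): `pairing_smul_smul`
import Literature.NumberTheory.Automorphic.UnitaryLatticeTreeDual                                  -- ★ (B-p14): `pairing_mulVec_mulVec` (`⟨gu, gv⟩_H = ⟨u, v⟩_{formCongr g H}`)
import HarnessLib

/-!
# (D-RAM) «FOUR-FRAME» road, unit (i), TIER 2: THE FOUR FRAME LITERALS ARE PAIRWISE NON-CONJUGATE — `⟦t_b⟧ = ⟦t_{b′}⟧ ⇒ b = b′`
# (payment of `U1_Frames.stub_U1_frameClasses_distinct`; (D-CΔ) clause (C)₂)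

Cell `pub/hodgecm-mathlib` (D-0151), crux H413 = `stmt-HodgeConjecture-24833`, organ (D-RAM) `stub_DyRamCore`, «FOUR-FRAME» road, Track A (LEAD T17-31 (R-9)); tier-1 socket
`Cruxes/H413/Lines/F0_P3c_DyRamFourFrame/U1_Frames.lean` (assembler B-p04, cand v2), stub **`stub_U1_frameClasses_distinct (N₀)`**: at a wild non-split place, for ANY four-frame
family `f` (H7), norm-one `a, b, z` with a REGULAR element datum for `(a², b²)` (E: `a² ≠ b²`, `a² ≠ 1`, `b² ≠ 1`), GL literals `Γ_b = frameElt σ_w f b (a²) (b²)` and group literals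
`t_b ∈ U(Φ₃)(L⁺_v)` whose one-place matrix is `z·Γ_b`: `⟦t_b⟧ = ⟦t_{b′}⟧ → b = b′`.

THE MATHEMATICS ([Rogawski1990, §3.6 pp. 31–32]: the `U(Φ₃)(F)`-classes inside a regular elliptic stable class are separated by the isometry classes of the hermitian form on the
eigenlines; [Jacobowitz1962, §4]).  If `y t_b y⁻¹ = t_{b′}` in `U(Φ₃)(L⁺_v)`, pass to the one-place model (★ `localNonsplitEquiv`, a group isomorphism onto `U(σ_w, Φ₃)(L_w)`):
the unitary matrix `U = ι_w(y)` satisfies `U·(zΓ_b)·U⁻¹ = zΓ_{b′}`, i.e. `U Γ_b = Γ_{b′} U` (`z ≠ 0`).  The frame vectors are eigenvectors, `Γ_b f_{b,j} = λ_j f_{b,j}` with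
`λ = (a², b², 1)` PAIRWISE DISTINCT (★ `frameElt_mulVec_frame`, §1), so `U f_{b,j}` is a `λ_j`-eigenvector of `Γ_{b′}`, hence a multiple `c·f_{b′,j}` of the frame vector (§1: the
eigenspaces of `Γ_{b′}` are the frame lines, by the invertible frame matrix ★ `isUnit_det_frameMatrix`).  Unitarity gives `N(f_{b,j}) = ⟨Uf, Uf⟩ = σ(c)c·N(f_{b′,j})`, so the NORM
CLASSES agree: `ω(N f_{b,j}) = ω(N f_{b′,j})` (§2), and by H7 the norm classes of slots `0, 1` ARE the frame index `signPair b ∈ {±1}²` (H4), whence `b = b′` (§3).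

* §1 `injective_frameEigenvalues`, **`exists_eq_smul_frame_of_eigenvector`** (eigenspaces of `Γ_b` are the frame lines).
* §2 `normSign_mul_norm` (`ω(σ(c)c·x) = ω(x)` for `c ≠ 0`), `signPair_injective`.
* §3 **`frameClasses_distinct`** — `U1_Frames.stub_U1_frameClasses_distinct` TOKEN FOR TOKEN.

HONEST LABEL: HC_CM is proved only modulo the 7 printed citations (2 remaining named inputs: hLiu418 = stmt-HodgeConjecture-24832, h413 = stmt-HodgeConjecture-24833) until rung 0
closes; `--supports stmt-HodgeConjecture-24833` helper; linear algebra over the one-place model.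
-/

noncomputable section

open scoped Valued WithZero Matrix MatrixGroups

namespace Summit.HodgeConjecture.HodgeConjecture.Cruxes.H413.F0P3cDyRamFrameClassesDistinct

open MeasureTheory Measure NumberField IsDedekindDomain Topology Filter
open Literature.NumberTheory.Automorphic Literature.NumberTheory.Automorphic.UnitaryGroup Literature.NumberTheory.Automorphic.IntegralReduction
open Literature.NumberTheory.Automorphic.UnitaryLatticeTree Literature.NumberTheory.Automorphic.HermitianLattice
open Literature.NumberTheory.Rogawski1990 Literature.NumberTheory.GaloisRepresentations
open Literature.NumberTheory.Automorphic.UnitaryThreeFourFrame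
open Summit.HodgeConjecture.HodgeConjecture.Cruxes.H413.F0P3cDyRamFrameApartmentVertex (pairing_smul_smul)
open scoped Classical

/-! ## §1  Eigenspaces of the frame literal are the frame lines -/

section Eigen

variable {K : Type} [Field K]

/-- The eigenvalue triple `(α, β, 1)` of a regular element datum is injective. [cite: Rogawski1990, §3.6 p. 31] -/
theorem injective_frameEigenvalues {α β : K} (hαβ : α ≠ β) (hα1 : α ≠ 1) (hβ1 : β ≠ 1) : Function.Injective (![α, β, 1] : Fin 3 → K) := by
  intro i j hij
  fin_cases i <;> fin_cases j
  all_goals first | rfl | (exfalso; revert hij; simp [hαβ, hα1, hβ1, hαβ.symm, hα1.symm, hβ1.symm])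

/-- **The eigenspaces of `Γ_b = frameElt σ f b α β` are the frame lines**: for a regular datum (`(α, β, 1)` pairwise distinct), every `x` with `Γ_b x = λ_j x` is a multiple of `f_{b,j}`
(coordinates in the invertible frame matrix: `(λ_k − λ_j) c_k = 0`). [cite: Rogawski1990, §3.6 p. 31] [cite: Jacobowitz1962, §4] -/
theorem exists_eq_smul_frame_of_eigenvector {σ : K →+* K} {f : Fin 4 → Fin 3 → (Fin 3 → K)} (hf : IsFourFrameFamily σ f) (b : Fin 4) {α β : K}
    (hαβ : α ≠ β) (hα1 : α ≠ 1) (hβ1 : β ≠ 1) (j : Fin 3) {x : Fin 3 → K}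
    (hx : frameElt σ f b α β *ᵥ x = (![α, β, 1] : Fin 3 → K) j • x) : ∃ c : K, x = c • f b j := by
  -- coordinates of `x` in the frame
  set Q : Matrix (Fin 3) (Fin 3) K := (Matrix.of (f b))ᵀ with hQ
  have hQdet : IsUnit Q.det := isUnit_det_frameMatrix hf b
  set c : Fin 3 → K := Q⁻¹ *ᵥ x with hc
  have hxQ : x = Q *ᵥ c := by rw [hc, Matrix.mulVec_mulVec, Matrix.mul_nonsing_inv _ hQdet, Matrix.one_mulVec]
  -- `Γ Q = Q D` turns the eigen-equation into `D c = λ_j c`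
  have hD : Q *ᵥ (Matrix.diagonal ![α, β, 1] *ᵥ c) = Q *ᵥ ((![α, β, 1] : Fin 3 → K) j • c) := by
    rw [Matrix.mulVec_mulVec, ← frameElt_mul_frameMatrix hf b α β, ← Matrix.mulVec_mulVec, ← hxQ, hx, hxQ, Matrix.mulVec_smul]
  have hDc : Matrix.diagonal ![α, β, 1] *ᵥ c = (![α, β, 1] : Fin 3 → K) j • c := frameMatrix_mulVec_injective hf b hD
  have hck : ∀ k, k ≠ j → c k = 0 := by
    intro k hkj
    have h := congrFun hDc k
    rw [Matrix.mulVec_diagonal, Pi.smul_apply, smul_eq_mul] at h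
    have hne : (![α, β, 1] : Fin 3 → K) k - (![α, β, 1] : Fin 3 → K) j ≠ 0 :=
      sub_ne_zero.2 fun h' => hkj (injective_frameEigenvalues hαβ hα1 hβ1 h')
    have h' : ((![α, β, 1] : Fin 3 → K) k - (![α, β, 1] : Fin 3 → K) j) * c k = 0 := by rw [sub_mul, h, sub_self]
    exact (mul_eq_zero.1 h').resolve_left hne
  refine ⟨c j, ?_⟩
  rw [hxQ, hQ, frameMatrix_mulVec, Finset.sum_eq_single j]
  · intro k _ hkj
    rw [hck k hkj, zero_smul]
  · exact fun h => (h (Finset.mem_univ j)).elim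

end Eigen

/-! ## §2  Norm classes and the frame index -/

section NormClass

variable {K : Type} [Field K] [Valued K ℤᵐ⁰]

omit [Valued K ℤᵐ⁰] in
/-- `ω(σ(c)·c·x) = ω(x)` for `c ≠ 0`: multiplying by a norm does not change the norm class (H1 `normSign`). [cite: Rogawski1990, §4.9 p. 55] -/
theorem normSign_mul_norm (σ : K →+* K) {c : K} (hc : c ≠ 0) (x : K) : normSign σ (σ c * c * x) = normSign σ x := by
  unfold normSign
  have hiff : (∃ z : K, z * σ z = σ c * c * x) ↔ ∃ z : K, z * σ z = x := by
    constructor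
    · rintro ⟨z, hz⟩
      refine ⟨z / c, ?_⟩
      have hσc : σ c ≠ 0 := (map_ne_zero σ).2 hc
      rw [map_div₀, div_mul_div_comm, hz]
      field_simp
    · rintro ⟨z, hz⟩
      exact ⟨c * z, by rw [map_mul, ← hz]; ring⟩
  rw [if_congr hiff rfl rfl]

/-- The frame index `b ↦ (ε₁, ε₂)` (H4 `signPair`) is injective. [cite: Rogawski1990, §4.9 p. 55] -/
theorem signPair_injective : Function.Injective signPair := by
  intro b₁ b₂ h
  fin_cases b₁ <;> fin_cases b₂
  all_goals first | rfl | (exfalso; revert h; simp [signPair])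

end NormClass

/-! ## §3  The head -/

/-- **PAYMENT OF `stub_U1_frameClasses_distinct`** (tier-1 socket `U1_Frames`, unit (i); (D-CΔ) clause (C)₂): the four frame literals `t_b` are pairwise non-conjugate in
`U(Φ₃)(L⁺_v)` — conjugacy transported to the one-place model gives a unitary intertwiner `U Γ_b = Γ_{b′} U`, which maps frame line to frame line (§1) and preserves norms, so the
norm classes `signPair b` and `signPair b′` of the first two frame vectors agree (§2). [cite: Rogawski1990, §3.6 pp. 31–32; §4.9 p. 55] [cite: Jacobowitz1962, §4] -/
theorem frameClasses_distinct (N₀ : ℕ → ℕ) :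
    ∀ (L : Type) [Field L] [NumberField L] [IsCMField L]
      {v : HeightOneSpectrum (𝓞 ↥(maximalRealSubfield L))} (w : UnitaryGroup.PlacesOver L v)
      (hw : IsCMField.complexConj L • w.1 = w.1) (_he : v.asIdeal.ramificationIdx' w.1.asIdeal ≠ 1)
      (_h2 : ¬ IsUnit (2 : (ValuativeRel.valuation (w.1.adicCompletion L)).integer))
      (ϖ : (w.1.adicCompletion L)) (_hϖ : Valued.v ϖ = WithZero.exp (-1 : ℤ)) (d tE : ℕ) (_hD : IsRamifiedQuadraticDatum (galAdicCompletionMap (L := L) (IsCMField.complexConj L) hw) ϖ d tE),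
        ∀ (f : Fin 4 → Fin 3 → (Fin 3 → (w.1.adicCompletion L))) (_ : IsFourFrameFamily (galAdicCompletionMap (L := L) (IsCMField.complexConj L) hw) f)
          (a b z : (w.1.adicCompletion L)) (_ : a * (galAdicCompletionMap (L := L) (IsCMField.complexConj L) hw) a = 1) (_ : b * (galAdicCompletionMap (L := L) (IsCMField.complexConj L) hw) b = 1) (_ : z * (galAdicCompletionMap (L := L) (IsCMField.complexConj L) hw) z = 1)
          (n₁ n₂ n₃ : ℕ) (_ : IsElementDatum (galAdicCompletionMap (L := L) (IsCMField.complexConj L) hw) ϖ (N₀ d) (a * a) (b * b) n₁ n₂ n₃)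
          (Γ : Fin 4 → GL (Fin 3) (w.1.adicCompletion L)) (_ : ∀ b', (Γ b' : Matrix (Fin 3) (Fin 3) (w.1.adicCompletion L)) = frameElt (galAdicCompletionMap (L := L) (IsCMField.complexConj L) hw) f b' (a * a) (b * b))
          (tb : Fin 4 → ((UnitaryGroup.cmDatum L 3 (Matrix.of fun i j : Fin 3 => if i.val + j.val + 1 = 3 then (1 : L) else 0)).Local v)) (_ : ∀ b', ((((localNonsplitEquiv (IsCMField.complexConj L) (Matrix.of fun i j : Fin 3 => if i.val + j.val + 1 = 3 then (1 : L) else 0) (IsCMField.complexConj_ne_one L) w hw (tb b') :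
              ↥(unitaryGroupOfForm (galAdicCompletionMap (L := L) (IsCMField.complexConj L) hw) (placeForm (Matrix.of fun i j : Fin 3 => if i.val + j.val + 1 = 3 then (1 : L) else 0) w.1))) : GL (Fin 3) (w.1.adicCompletion L)) : Matrix (Fin 3) (Fin 3) (w.1.adicCompletion L))) = z • (Γ b' : Matrix (Fin 3) (Fin 3) (w.1.adicCompletion L))),
          (∀ b' b'' : Fin 4, ConjClasses.mk (tb b') = ConjClasses.mk (tb b'') → b' = b'') := by
  intro L _ _ _ v w hw _he _h2 ϖ _hϖ d tE _hD f hf a b z _ha _hb hz n₁ n₂ n₃ hE Γ hΓ tb htb b₁ b₂ hconj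
  -- notation
  set σw := galAdicCompletionMap (L := L) (IsCMField.complexConj L) hw with hσw
  set e := localNonsplitEquiv (IsCMField.complexConj L) (Matrix.of fun i j : Fin 3 => if i.val + j.val + 1 = 3 then (1 : L) else 0)
    (IsCMField.complexConj_ne_one L) w hw with he_def
  obtain ⟨-, -, hαβ, hα1, hβ1, -⟩ := hE
  have hz0 : z ≠ 0 := fun h => by rw [h, zero_mul] at hz; exact zero_ne_one hz
  -- conjugacy, transported to the one-place model: `U (zΓ₁) U⁻¹ = zΓ₂`
  obtain ⟨y, hy⟩ := isConj_iff.1 (ConjClasses.mk_eq_mk_iff_isConj.1 hconj)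
  set U : GL (Fin 3) (w.1.adicCompletion L) := ((e y : ↥(unitaryGroupOfForm σw (placeForm (Matrix.of fun i j : Fin 3 => if i.val + j.val + 1 = 3 then (1 : L) else 0) w.1))) :
    GL (Fin 3) (w.1.adicCompletion L)) with hU_def
  have hUmem : U ∈ unitaryGroupOfForm σw ((StdForm.antidiagonal 3).over (w.1.adicCompletion L)) := by
    rw [← placeForm_antidiagOne]
    exact (e y).2
  have hconjM : (U : Matrix (Fin 3) (Fin 3) (w.1.adicCompletion L)) * (z • (Γ b₁ : Matrix (Fin 3) (Fin 3) (w.1.adicCompletion L))) =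
      (z • (Γ b₂ : Matrix (Fin 3) (Fin 3) (w.1.adicCompletion L))) * (U : Matrix (Fin 3) (Fin 3) (w.1.adicCompletion L)) := by
    have hy' : y * tb b₁ = tb b₂ * y := by rw [← hy]; group
    -- `e` is multiplicative (term-mode `map_mul`: the carrier `(cmDatum …).Local v` is the subgroup `↥(local …)` by `def`, so `rw` cannot see through it)
    have h1 : e (y * tb b₁) = e y * e (tb b₁) := map_mul e y (tb b₁)
    have h1' : e (tb b₂ * y) = e (tb b₂) * e y := map_mul e (tb b₂) y
    have key : e y * e (tb b₁) = e (tb b₂) * e y := by rw [← h1, ← h1']; exact congrArg e hy'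
    have h2 := congrArg (fun g : ↥(unitaryGroupOfForm σw (placeForm (Matrix.of fun i j : Fin 3 => if i.val + j.val + 1 = 3 then (1 : L) else 0) w.1)) =>
      ((g : GL (Fin 3) (w.1.adicCompletion L)) : Matrix (Fin 3) (Fin 3) (w.1.adicCompletion L))) key
    simp only [Subgroup.coe_mul, Units.val_mul] at h2
    rw [htb b₁, htb b₂] at h2
    exact h2
  have hUΓ : (U : Matrix (Fin 3) (Fin 3) (w.1.adicCompletion L)) * (Γ b₁ : Matrix (Fin 3) (Fin 3) (w.1.adicCompletion L)) =
      (Γ b₂ : Matrix (Fin 3) (Fin 3) (w.1.adicCompletion L)) * (U : Matrix (Fin 3) (Fin 3) (w.1.adicCompletion L)) := by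
    rw [Matrix.mul_smul, Matrix.smul_mul] at hconjM
    exact smul_right_injective _ hz0 hconjM
  -- slot by slot: `U f_{b₁,j}` is a `λ_j`-eigenvector of `Γ_{b₂}`, hence `c • f_{b₂,j}`, and the norm classes agree
  have hslot : ∀ j : Fin 3, normSign σw (pairing σw ((StdForm.antidiagonal 3).over (w.1.adicCompletion L)) (f b₁ j) (f b₁ j)) =
      normSign σw (pairing σw ((StdForm.antidiagonal 3).over (w.1.adicCompletion L)) (f b₂ j) (f b₂ j)) := by
    intro j
    have heig : frameElt σw f b₂ (a * a) (b * b) *ᵥ ((U : Matrix (Fin 3) (Fin 3) (w.1.adicCompletion L)) *ᵥ f b₁ j) =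
        (![a * a, b * b, 1] : Fin 3 → (w.1.adicCompletion L)) j • ((U : Matrix (Fin 3) (Fin 3) (w.1.adicCompletion L)) *ᵥ f b₁ j) := by
      rw [← hΓ b₂, Matrix.mulVec_mulVec, ← hUΓ, ← Matrix.mulVec_mulVec, hΓ b₁, frameElt_mulVec_frame hf b₁ (a * a) (b * b) j, Matrix.mulVec_smul]
    obtain ⟨c, hc⟩ := exists_eq_smul_frame_of_eigenvector hf b₂ hαβ hα1 hβ1 j heig
    have hnorm : pairing σw ((StdForm.antidiagonal 3).over (w.1.adicCompletion L)) (f b₁ j) (f b₁ j) =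
        σw c * c * pairing σw ((StdForm.antidiagonal 3).over (w.1.adicCompletion L)) (f b₂ j) (f b₂ j) := by
      rw [← pairing_smul_smul, ← hc, pairing_mulVec_mulVec]
      have hUu : formCongr σw U ((StdForm.antidiagonal 3).over (w.1.adicCompletion L)) = (StdForm.antidiagonal 3).over (w.1.adicCompletion L) := hUmem
      rw [hUu]
    have hc0 : c ≠ 0 := by
      intro h0
      rw [h0, map_zero, zero_mul, zero_mul] at hnorm
      exact (hf b₁).2.1 j hnorm
    rw [hnorm, normSign_mul_norm σw hc0]
  -- the frame index is read off slots 0 and 1 (H7)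
  obtain ⟨-, -, h10, h11, -⟩ := hf b₁
  obtain ⟨-, -, h20, h21, -⟩ := hf b₂
  apply signPair_injective
  exact Prod.ext (by rw [← h10, ← h20, hslot 0]) (by rw [← h11, ← h21, hslot 1])


end Summit.HodgeConjecture.HodgeConjecture.Cruxes.H413.F0P3cDyRamFrameClassesDistinct

end
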